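import Summits.ValiantsHypothesis.ValiantsHypothesis.Theorems.BarrierLeverPartitionMinorsHitByVPHiddenStatesSymbolic

/-!
# Route BarrierLever — item `PartitionMinorsHitByVP` (stmt-ValiantsHypothesis-19717), line `hidden_states`:
# the POINT-SHED step — a single member is always an exact zero set (Hamming-distance cut)

Helper file (`--supports stmt-ValiantsHypothesis-19717`; cell valiant-natproofs, rung V4, 𝒟-side door (c); prover seat val-np-p6 gen 9).
Definition-free. Closes NO item.

`SymbJoin.symGood_shed_point`: at a coordinate `x` avoided by exactly ONE row `i₀`, any single column `k₀` may be sent alone to the deletion side: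
if the link configuration (the other rows with `x` erased, the other columns) is generically good, so is the whole. It is the instance `r₀ = 1` of
val-np-p3 g10's symbolic split theorem (`symGood_of_split`, p585554) with the HAMMING-DISTANCE cut constants `β = |J₀|`, `γ_q = −1 (q ∈ J₀)`,
`γ_q = +1 (q ∉ J₀)` on the piece of `k₀` (so `ξ(J) = |J Δ J₀|` vanishes exactly at `J = J₀` among the DISTINCT hidden sets of that piece) and
`ξ ≡ 1` on the other pieces; the `1 × 1` deletion block is good by `symGood_of_lonely`.

WHY (memo HOME/val-np-p6/g9 §6): the weighted-ball TYPE game (Pascal + merge cuts) cannot serve co-small sub-families with cube-like pieces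
(`Q₃` vs the 8 co-points of `[8]`: exhaustive loss), while shedding one point per level wins in 5 nodes; with this step (+ the exact small-part
endgame) the solver G3x (kit/wball3.py) decides the whole former frontier of the weighted-ball census ((9,502), (11,1816), (12,4080), … all WIN).
This file makes the point-shed node a named kernel step beside `symGood_of_pascalSplit` (p594262) and `symGood_of_ballSplit` (p597731).

WHAT THIS IS NOT: no family is certified here; item 19717 OPEN; nothing on crux 14610 or VP ≠ VNP.
-/

set_option linter.dupNamespace false

namespace Summit.ValiantsHypothesis.ValiantsHypothesis.Theorems.BarrierLever.HiddenStates

open Finset Matrix MvPolynomial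

noncomputable section

namespace SymbJoin

variable {h m K r : ℕ}

/-- The Hamming-distance cut value: with `β = |J₀|`, `γ_q = −1` on `J₀` and `+1` off `J₀`, the cut value of a hidden set `J` of the same piece is
`|J ∖ J₀| + |J₀ ∖ J|` (as a complex number), hence zero iff `J = J₀`. -/
theorem xi_hamming (e : Fin r → Fin m × Finset (Fin K)) (p₀ : Fin m) (J₀ : Finset (Fin K)) (k : Fin r) (hk : (e k).1 = p₀) :
    xi e (fun p => if p = p₀ then (J₀.card : ℂ) else 1) (fun p q => if p = p₀ then (if q ∈ J₀ then -1 else 1) else 0) k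
      = (((e k).2 \ J₀).card : ℂ) + (((J₀ \ (e k).2)).card : ℂ) := by
  classical
  simp only [xi, hk, if_true]
  rw [Finset.sum_ite, Finset.sum_const, Finset.sum_const, nsmul_eq_mul, nsmul_eq_mul, mul_one, mul_neg, mul_one]
  have h1 : ((e k).2.filter fun q => q ∈ J₀) = (e k).2 ∩ J₀ := Finset.filter_mem_eq_inter
  have h2 : ((e k).2.filter fun q => ¬ q ∈ J₀) = (e k).2 \ J₀ := by ext q; simp [Finset.mem_sdiff]
  rw [h1, h2]
  have hc : (J₀.card : ℂ) = (((e k).2 ∩ J₀).card : ℂ) + ((J₀ \ (e k).2).card : ℂ) := by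
    rw [← Nat.cast_add, Finset.inter_comm, Finset.card_inter_add_card_sdiff]
  rw [hc]; ring

/-- The Hamming cut value vanishes exactly at `J₀`. -/
theorem xi_hamming_eq_zero_iff (e : Fin r → Fin m × Finset (Fin K)) (p₀ : Fin m) (J₀ : Finset (Fin K)) (k : Fin r) (hk : (e k).1 = p₀) :
    xi e (fun p => if p = p₀ then (J₀.card : ℂ) else 1) (fun p q => if p = p₀ then (if q ∈ J₀ then -1 else 1) else 0) k = 0 ↔
      (e k).2 = J₀ := by
  rw [xi_hamming e p₀ J₀ k hk, ← Nat.cast_add, Nat.cast_eq_zero, Nat.add_eq_zero_iff, Finset.card_eq_zero, Finset.card_eq_zero,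
    Finset.sdiff_eq_empty_iff_subset, Finset.sdiff_eq_empty_iff_subset]
  exact ⟨fun ⟨h1, h2⟩ => Finset.Subset.antisymm h1 h2, fun h => ⟨h.le, h.ge⟩⟩

/-- Off the piece `p₀` the Hamming cut value is `1`. -/
theorem xi_hamming_other (e : Fin r → Fin m × Finset (Fin K)) (p₀ : Fin m) (J₀ : Finset (Fin K)) (k : Fin r) (hk : (e k).1 ≠ p₀) :
    xi e (fun p => if p = p₀ then (J₀.card : ℂ) else 1) (fun p q => if p = p₀ then (if q ∈ J₀ then -1 else 1) else 0) k = 1 := by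
  simp [xi, hk]

/-- **THE POINT-SHED STEP.** Rows/columns indexed by `Fin (r₁ + 1)`, columns injective (distinct (piece, hidden set) pairs). If `x` is avoided
by the row `i₀` only, `k₀` is any column, and the link configuration «rows `i₀.succAbove j` with `x` erased, columns `k₀.succAbove j`» is
generically good, then the whole configuration is generically good. -/
theorem symGood_shed_point {r₁ : ℕ} (u : Fin (r₁ + 1) → Finset (Fin h)) (e : Fin (r₁ + 1) → Fin m × Finset (Fin K))
    (he : Function.Injective e) (x : Fin h) (i₀ k₀ : Fin (r₁ + 1))
    (hrow0 : x ∉ u i₀) (hrow1 : ∀ j : Fin r₁, x ∈ u (i₀.succAbove j))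
    (h1 : symDet (fun j : Fin r₁ => (u (i₀.succAbove j)).erase x) (fun j => e (k₀.succAbove j)) ≠ 0) :
    symDet u e ≠ 0 := by
  classical
  -- the reindexing `Fin 1 ⊕ Fin r₁ ≃ Fin (r₁ + 1)` around a pivot
  let piv : Fin (r₁ + 1) → (Fin 1 ⊕ Fin r₁ ≃ Fin (r₁ + 1)) := fun c =>
    { toFun := Sum.elim (fun _ => c) c.succAbove
      invFun := fun i => if hi : i = c then Sum.inl 0 else Sum.inr ((Fin.exists_succAbove_eq hi).choose)
      left_inv := by
        rintro (j | j)
        · simp; exact Subsingleton.elim _ _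
        · have hne : c.succAbove j ≠ c := Fin.succAbove_ne c j
          simp only [Sum.elim_inr, hne, dif_neg, not_false_eq_true, Sum.inr.injEq]
          exact Fin.succAbove_right_injective (Fin.exists_succAbove_eq hne).choose_spec
      right_inv := by
        intro i
        by_cases hi : i = c
        · simp [hi]
        · simp only [hi, dif_neg, not_false_eq_true, Sum.elim_inr]
          exact (Fin.exists_succAbove_eq hi).choose_spec }
  set p₀ := (e k₀).1 with hp₀
  set J₀ := (e k₀).2 with hJ₀
  refine symGood_of_split u e x (fun p => if p = p₀ then (J₀.card : ℂ) else 1)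
    (fun p q => if p = p₀ then (if q ∈ J₀ then -1 else 1) else 0) (piv i₀) (piv k₀) ?_ ?_ ?_ ?_ ?_ ?_
  · intro j; simpa [piv] using hrow0
  · intro j; simpa [piv] using hrow1 j
  · intro j
    have : (piv k₀) (Sum.inl j) = k₀ := by simp [piv]
    rw [this, xi_hamming_eq_zero_iff e p₀ J₀ k₀ rfl]
  · intro j
    have hk : (piv k₀) (Sum.inr j) = k₀.succAbove j := by simp [piv]
    rw [hk]
    by_cases hp : (e (k₀.succAbove j)).1 = p₀
    · rw [Ne, xi_hamming_eq_zero_iff e p₀ J₀ _ hp]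
      intro hJ
      have : e (k₀.succAbove j) = e k₀ := Prod.ext hp hJ
      exact Fin.succAbove_ne k₀ j (he this)
    · rw [xi_hamming_other e p₀ J₀ _ hp]; exact one_ne_zero
  · -- the 1 × 1 deletion block
    have hu1 : Function.Injective fun j : Fin 1 => u ((piv i₀) (Sum.inl j)) := fun a b _ => Subsingleton.elim a b
    exact symGood_of_lonely _ hu1 _ fun a b _ => Subsingleton.elim a b
  · simpa [piv] using h1

end SymbJoin

end

end Summit.ValiantsHypothesis.ValiantsHypothesis.Theorems.BarrierLever.HiddenStates
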